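import Mathlib.Analysis.SpecialFunctions.Pow.Complex
import Mathlib.MeasureTheory.Integral.Bochner.Basic
import Mathlib.MeasureTheory.Measure.Lebesgue.Basic
import HarnessLib

/-!
# Lagarias–Rains (2003), §7.3 Question 1 — the statement

J. C. Lagarias and E. Rains, *On a two-variable zeta function for number fields*, Ann. Inst.
Fourier **53** (2003) 1–68 [LagariasRains2003], define (eq. (1.4), (1.5)) the theta function
`θ(t) = Σ_{n ∈ ℤ} e^{−π n² t}` and the (Arakelov) two-variable zeta function of `ℚ`,
`Z_ℚ(w, s) = ∫_0^∞ θ(t²)^s θ(1/t²)^{w−s} dt/t`,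
whose integral converges absolutely on the open cone `{Re w < Re s < 0}` (containing the
real-codimension one cone `C⁻ = {(w, s) : w = u ∈ ℝ, u < Re s < 0}` of their §7.2), and ask
(§7.3, verbatim): "Question 1. Is `Re(Z(w, s)) > 0` in the entire real-codimension one cone
`C⁻ := {(w, s) : w = u ∈ ℝ, u < Re(s) < 0}`?"

This file only types the question (`Question1`); `LagariasRains2003.Refutation` answers it in the
negative at the point `(w, s) = (−16, −1/100 + i) ∈ C⁻`.
-/

open MeasureTheory Set

namespace Literature.NumberTheory.LFunctions.LagariasRains2003

/-- (1.4): `θ(t) = Σ_{n ∈ ℤ} e^{−π n² t}`. [cite: LagariasRains2003, (1.4)] -/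
noncomputable def theta (t : ℝ) : ℝ := ∑' n : ℤ, Real.exp (-Real.pi * (n : ℝ) ^ 2 * t)

/-- (1.5): the two-variable zeta function of `ℚ`,
`Z_ℚ(w, s) = ∫_0^∞ θ(t²)^s θ(1/t²)^{w−s} dt/t` (complex powers of the positive reals `θ(·)`;
absolutely convergent for `Re w < Re s < 0`). [cite: LagariasRains2003, (1.5)] -/
noncomputable def ZQ (w s : ℂ) : ℂ :=
  ∫ t in Ioi (0 : ℝ), ((theta (t ^ 2) : ℂ) ^ s * (theta (1 / t ^ 2) : ℂ) ^ (w - s)) / (t : ℂ)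

/-- The real-codimension one cone `C⁻ = {(w, s) : w = u ∈ ℝ, u < Re s < 0}` of §7.2–§7.3.
[cite: LagariasRains2003, §7.3] -/
def coneMinus : Set (ℂ × ℂ) := {p | ∃ u : ℝ, p.1 = (u : ℂ) ∧ u < p.2.re ∧ p.2.re < 0}

/-- **Question 1** (§7.3): "Is `Re(Z(w, s)) > 0` in the entire real-codimension one cone
`C⁻ := {(w, s) : w = u ∈ ℝ, u < Re(s) < 0}`?" — as the proposition that the answer is *yes*.
[cite: LagariasRains2003, §7.3 Question 1] -/
def Question1 : Prop := ∀ w s : ℂ, (w, s) ∈ coneMinus → 0 < (ZQ w s).re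

end Literature.NumberTheory.LFunctions.LagariasRains2003
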